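import Mathlib
import Summits.ValiantsHypothesis.ValiantsHypothesis.Theorems.GrenetZeonTwoDimCoefficientsGradedTopTrace

/-!
# Crux `GrenetZeon.TwoDimCoefficients` (stmt-ValiantsHypothesis-8062) / rung `DualUnipotentThreeHalves` (stmt-24318):
# path factorization of the resolvent of a CONSECUTIVE-LEVEL GRADED nilpotent matrix

Memo TWENTY-SECOND HAND (evidence on both items), kernel plan §4 step 2.  For a constant `m × m` matrix `Z` that is
consecutive-level graded for `lvl : Fin m → ℕ` (`Z a b ≠ 0 ⇒ lvl b = lvl a + 1`) with `Z^m = 0`, the resolvent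
`K = Σ_{j<m} Z^j = (1 − Z)⁻¹` is the matrix of graded path sums, and paths from level `lvl a` to level `lvl b` cross every
intermediate level `q` exactly once:

* (✓ `GradedTopTrace.pow_apply_eq_zero_of_graded`, imported) `(Z^k) a b = 0` unless `lvl b = lvl a + k`;
* `resolvent_apply_of_lvl_le` / `resolvent_apply_of_lvl_lt` — `K a b = (Z^{lvl b − lvl a}) a b` (`lvl a ≤ lvl b`), `K a b = 0` (`lvl b < lvl a`);
* ★ `resolvent_apply_eq_sum_level` — PIVOT FACTORIZATION `K a b = Σ_{c : lvl c = q} K a c · K c b` for `lvl a ≤ q ≤ lvl b`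
  (`K[u ← v] = K[u ← q]·K[q ← v]`), the identity behind the coordinated-pivot slot factors of Theorem T7.

Pure bookkeeping over a commutative ring.  HONEST FRAMING: a brick; the stub `DualUnipotentBound`, the 24318 decl,
`stub_longMassSlowLawInv` and `VP ≠ VNP` remain open.

References: folklore linear algebra.
-/

-- single-conjunct layout `Summits/ValiantsHypothesis/ValiantsHypothesis`: the duplicated namespace
-- component is mandated by the tree.
set_option linter.dupNamespace false
set_option autoImplicit false

namespace Summit.ValiantsHypothesis.ValiantsHypothesis.Theorems.GrenetZeonTwoDimCoefficients.GradedPathFactor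

open Matrix
open Summit.ValiantsHypothesis.ValiantsHypothesis.Theorems.GrenetZeonTwoDimCoefficients.GradedTopTrace
  (pow_apply_eq_zero_of_graded)

variable {R : Type*} [CommRing R] {m : ℕ} (lvl : Fin m → ℕ)

/-- Powers at or beyond the size vanish entrywise when `Z^m = 0`. [folklore] -/
theorem pow_apply_eq_zero_of_le (Z : Matrix (Fin m) (Fin m) R) (hZm : Z ^ m = 0) {k : ℕ} (hk : m ≤ k)
    (a b : Fin m) : (Z ^ k) a b = 0 := by
  obtain ⟨d, rfl⟩ := Nat.exists_eq_add_of_le hk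
  rw [pow_add, hZm, Matrix.zero_mul, Matrix.zero_apply]

/-- The resolvent entry is the single graded power: `K a b = (Z^{lvl b − lvl a}) a b` for `lvl a ≤ lvl b`. [folklore] -/
theorem resolvent_apply_of_lvl_le (Z : Matrix (Fin m) (Fin m) R)
    (hZ : ∀ a b, lvl b ≠ lvl a + 1 → Z a b = 0) (hZm : Z ^ m = 0) (a b : Fin m) (hab : lvl a ≤ lvl b) :
    (∑ j ∈ Finset.range m, Z ^ j) a b = (Z ^ (lvl b - lvl a)) a b := by
  rw [Matrix.sum_apply]
  by_cases hd : lvl b - lvl a < m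
  · rw [Finset.sum_eq_single (lvl b - lvl a)]
    · intro j _ hj
      exact pow_apply_eq_zero_of_graded lvl Z hZ j a b (by omega)
    · intro h
      exact absurd (Finset.mem_range.mpr hd) h
  · rw [pow_apply_eq_zero_of_le Z hZm (by omega) a b]
    refine Finset.sum_eq_zero fun j hj => ?_
    rw [Finset.mem_range] at hj
    exact pow_apply_eq_zero_of_graded lvl Z hZ j a b (by omega)

/-- Paths never descend: `K a b = 0` for `lvl b < lvl a`. [folklore] -/
theorem resolvent_apply_of_lvl_lt (Z : Matrix (Fin m) (Fin m) R)
    (hZ : ∀ a b, lvl b ≠ lvl a + 1 → Z a b = 0) (a b : Fin m) (hab : lvl b < lvl a) :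
    (∑ j ∈ Finset.range m, Z ^ j) a b = 0 := by
  rw [Matrix.sum_apply]
  refine Finset.sum_eq_zero fun j _ => ?_
  exact pow_apply_eq_zero_of_graded lvl Z hZ j a b (by omega)

/-- ★ **Pivot factorization.**  Every graded path from level `lvl a` to level `lvl b` crosses an intermediate level `q`
exactly once: `K a b = Σ_{c : lvl c = q} K a c · K c b` for `lvl a ≤ q ≤ lvl b`, `K = Σ_{j<m} Z^j`. [folklore] -/
theorem resolvent_apply_eq_sum_level (Z : Matrix (Fin m) (Fin m) R)
    (hZ : ∀ a b, lvl b ≠ lvl a + 1 → Z a b = 0) (hZm : Z ^ m = 0) (a b : Fin m) (q : ℕ)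
    (haq : lvl a ≤ q) (hqb : q ≤ lvl b) :
    (∑ j ∈ Finset.range m, Z ^ j) a b =
      ∑ c ∈ Finset.univ.filter (fun c => lvl c = q),
        (∑ j ∈ Finset.range m, Z ^ j) a c * (∑ j ∈ Finset.range m, Z ^ j) c b := by
  rw [resolvent_apply_of_lvl_le lvl Z hZ hZm a b (haq.trans hqb)]
  have hsplit : lvl b - lvl a = (q - lvl a) + (lvl b - q) := by omega
  rw [hsplit, pow_add, Matrix.mul_apply]
  -- only the indices at level `q` survive in the full sum
  rw [← Finset.sum_filter_add_sum_filter_not Finset.univ (fun c => lvl c = q)]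
  have hzero : ∑ c ∈ Finset.univ.filter (fun c => ¬ lvl c = q),
      (Z ^ (q - lvl a)) a c * (Z ^ (lvl b - q)) c b = 0 := by
    refine Finset.sum_eq_zero fun c hc => ?_
    rw [Finset.mem_filter] at hc
    rw [pow_apply_eq_zero_of_graded lvl Z hZ (q - lvl a) a c (by omega), zero_mul]
  rw [hzero, add_zero]
  refine Finset.sum_congr rfl fun c hc => ?_
  rw [Finset.mem_filter] at hc
  obtain ⟨-, rfl⟩ := hc
  rw [resolvent_apply_of_lvl_le lvl Z hZ hZm a c haq, resolvent_apply_of_lvl_le lvl Z hZ hZm c b hqb]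

/-- Matrix form of the pivot factorization: with the level projector `Π_q = diag([lvl i = q])`,
`(K·Π_q·K) a b = K a b` whenever `lvl a ≤ q ≤ lvl b`. [folklore] -/
theorem resolvent_mul_levelProj_mul_resolvent_apply (Z : Matrix (Fin m) (Fin m) R)
    (hZ : ∀ a b, lvl b ≠ lvl a + 1 → Z a b = 0) (hZm : Z ^ m = 0) (a b : Fin m) (q : ℕ)
    (haq : lvl a ≤ q) (hqb : q ≤ lvl b) :
    ((∑ j ∈ Finset.range m, Z ^ j) * Matrix.diagonal (fun i => if lvl i = q then (1 : R) else 0) *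
        (∑ j ∈ Finset.range m, Z ^ j)) a b = (∑ j ∈ Finset.range m, Z ^ j) a b := by
  classical
  rw [resolvent_apply_eq_sum_level lvl Z hZ hZm a b q haq hqb, Matrix.mul_apply, Finset.sum_filter]
  refine Finset.sum_congr rfl fun c _ => ?_
  rw [Matrix.mul_diagonal]
  split_ifs with h
  · rw [mul_one]
  · rw [mul_zero, zero_mul]

end Summit.ValiantsHypothesis.ValiantsHypothesis.Theorems.GrenetZeonTwoDimCoefficients.GradedPathFactor
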